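import Mathlib
import Literature.Analysis.FluidPDE.NSBoundedMildSmoothing
import HarnessLib

/-!
# Two bookkeeping lemmas for the KNSS sup-zoom of a witness of `CertifiedBlowupAxisymBlowup`: the shifted Lipschitz
# window and the comparison of the two zoom normalisations

Theorems file landed `--supports stmt-NavierStokesRegularity-0727 --as helper` (crux `CertifiedBlowupAxisymBlowup`,
sub-skeleton "axis-aware KNSS sup-zoom of a witness"); consumed by the registered stub
`zoom_dichotomy_of_isMaximalSmoothSolution` (`CertifiedBlowupAxisymBlowupZoomDichotomy`). Given the uniform space–time
Lipschitz modulus `L` on `[−1, 0]` windows of bounded Oseen-mild fields (the conclusion of the landed stub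
`zoom_window_lipschitz`, taken here as a HYPOTHESIS `hL` so that this file is notation-free):
* `windowLipschitz_shift` — the same modulus on `[s₀ − 1, s₀]` for every `s₀ ≤ 0` with `A ≤ s₀ − 3` (time translation,
  `oseenDuhamel_translate`);
* `zoom_rescale_compare` — for zooms `Vₙ` with windows `Aₙ → −∞`, bound `2` on `(Aₙ, 0]` and factors `γₙ ≥ 1`, `γₙ → 1`:
  `γₙ⁻¹ Vₙ(s/γₙ², y/γₙ) − Vₙ(s, y) → 0` pointwise (`s < 0`) — the scale-`λ` and scale-`λ/γ` zooms have the same limits.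
No definitions, no `sorry`. WHAT THIS IS NOT: regularity bookkeeping for GIVEN bounded mild fields; nothing about blow-up.
Cell `ns-blowup`, zone Z1 (profile-eng-1 g9).
-/

set_option linter.dupNamespace false

noncomputable section

open MeasureTheory Set Function Filter Topology Metric
open scoped NNReal ENNReal

namespace Summit.NavierStokesRegularity.NavierStokesRegularity.Theorems.CertifiedBlowupAxisymBlowup.CompactAmplification

open Literature.Analysis Literature.Analysis.FluidPDE Literature.Analysis.UnboundedOperators

/-- **Shifted window**: the Lipschitz modulus on `[s₀ − 1, s₀]` for any `s₀ ≤ 0` with `A ≤ s₀ − 3` (time translation by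
`s₀`, `oseenDuhamel_translate`). [folklore] -/
theorem windowLipschitz_shift {L : ℝ}
    (hL : (∀ (V : ℝ → (EuclideanSpace ℝ (Fin 3)) → (EuclideanSpace ℝ (Fin 3))) (A B : ℝ), A ≤ -3 → 0 < B →
      ContinuousOn (uncurry V) (Ioo A B ×ˢ univ) → (∀ s ∈ Ioc A 0, ∀ y, ‖V s y‖ ≤ 2) →
      (∀ s ∈ Ioo A B, IsWeaklyDivFree (V s)) →
      (∀ s t : ℝ, A < s → s < t → t ≤ 0 → ∀ x, V t x = heatExtension (V s) (t - s) x - oseenDuhamel 1 s V V t x) →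
      ∀ s ∈ Icc (-1 : ℝ) 0, ∀ t ∈ Icc (-1 : ℝ) 0, ∀ x y : (EuclideanSpace ℝ (Fin 3)), ‖V t x - V s y‖ ≤ L * (|t - s| + ‖x - y‖)))
    (V : ℝ → (EuclideanSpace ℝ (Fin 3)) → (EuclideanSpace ℝ (Fin 3))) (A B : ℝ) {s₀ : ℝ}
    (hs₀ : s₀ ≤ 0) (hA : A ≤ s₀ - 3) (hB : 0 < B) (hcont : ContinuousOn (uncurry V) (Ioo A B ×ˢ univ))
    (hbd : ∀ s ∈ Ioc A 0, ∀ y, ‖V s y‖ ≤ 2) (hdiv : ∀ s ∈ Ioo A B, IsWeaklyDivFree (V s))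
    (hmild : ∀ s t : ℝ, A < s → s < t → t ≤ 0 → ∀ x,
      V t x = heatExtension (V s) (t - s) x - oseenDuhamel 1 s V V t x) :
    ∀ s ∈ Icc (s₀ - 1) s₀, ∀ t ∈ Icc (s₀ - 1) s₀, ∀ x y : (EuclideanSpace ℝ (Fin 3)), ‖V t x - V s y‖ ≤ L * (|t - s| + ‖x - y‖) := by
  intro s hs t ht x y
  set U : ℝ → (EuclideanSpace ℝ (Fin 3)) → (EuclideanSpace ℝ (Fin 3)) := fun τ => V (τ + s₀) with hU
  have hcontU : ContinuousOn (uncurry U) (Ioo (A - s₀) (B - s₀) ×ˢ univ) := by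
    have hmap : Continuous fun q : ℝ × (EuclideanSpace ℝ (Fin 3)) => (q.1 + s₀, q.2) := (continuous_fst.add continuous_const).prodMk continuous_snd
    refine (hcont.comp hmap.continuousOn fun q hq => ⟨⟨?_, ?_⟩, mem_univ _⟩).congr fun q _ => rfl
    · have := (mem_prod.1 hq).1.1; linarith
    · have := (mem_prod.1 hq).1.2; linarith
  have hbdU : ∀ σ ∈ Ioc (A - s₀) 0, ∀ z, ‖U σ z‖ ≤ 2 := fun σ hσ z =>
    hbd (σ + s₀) ⟨by linarith [hσ.1], by linarith [hσ.2]⟩ z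
  have hdivU : ∀ σ ∈ Ioo (A - s₀) (B - s₀), IsWeaklyDivFree (U σ) := fun σ hσ =>
    hdiv (σ + s₀) ⟨by linarith [hσ.1], by linarith [hσ.2]⟩
  have hmildU : ∀ σ τ : ℝ, A - s₀ < σ → σ < τ → τ ≤ 0 → ∀ z,
      U τ z = heatExtension (U σ) (τ - σ) z - oseenDuhamel 1 σ U U τ z := by
    intro σ τ hσ hστ hτ z
    have h := hmild (σ + s₀) (τ + s₀) (by linarith) (by linarith) (by linarith) z
    rw [show τ + s₀ - (σ + s₀) = τ - σ by ring] at h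
    rw [hU, oseenDuhamel_translate]
    exact h
  have h := hL U (A - s₀) (B - s₀) (by linarith) (by linarith) hcontU hbdU hdivU hmildU (s - s₀)
    ⟨by linarith [hs.1], by linarith [hs.2]⟩ (t - s₀) ⟨by linarith [ht.1], by linarith [ht.2]⟩ x y
  simp only [hU, sub_add_cancel] at h
  rwa [show t - s₀ - (s - s₀) = t - s by ring] at h



/-- **Comparison of the two normalisations of the zoom** (scale `λ` vs `λ/γ`, `γ → 1`): pointwise, the difference
tends to zero, by the shifted Lipschitz modulus. [folklore] -/
theorem zoom_rescale_compare {L : ℝ}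
    (hL : (∀ (V : ℝ → (EuclideanSpace ℝ (Fin 3)) → (EuclideanSpace ℝ (Fin 3))) (A B : ℝ), A ≤ -3 → 0 < B →
      ContinuousOn (uncurry V) (Ioo A B ×ˢ univ) → (∀ s ∈ Ioc A 0, ∀ y, ‖V s y‖ ≤ 2) →
      (∀ s ∈ Ioo A B, IsWeaklyDivFree (V s)) →
      (∀ s t : ℝ, A < s → s < t → t ≤ 0 → ∀ x, V t x = heatExtension (V s) (t - s) x - oseenDuhamel 1 s V V t x) →
      ∀ s ∈ Icc (-1 : ℝ) 0, ∀ t ∈ Icc (-1 : ℝ) 0, ∀ x y : (EuclideanSpace ℝ (Fin 3)), ‖V t x - V s y‖ ≤ L * (|t - s| + ‖x - y‖)))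
    (V : ℕ → ℝ → (EuclideanSpace ℝ (Fin 3)) → (EuclideanSpace ℝ (Fin 3)))
    (A B γ : ℕ → ℝ) (hAlim : Tendsto A atTop atBot) (hB : ∀ n, 0 < B n)
    (hcont : ∀ n, ContinuousOn (uncurry (V n)) (Ioo (A n) (B n) ×ˢ univ))
    (hbd : ∀ n, ∀ s ∈ Ioc (A n) 0, ∀ y, ‖V n s y‖ ≤ 2) (hdiv : ∀ n, ∀ s ∈ Ioo (A n) (B n), IsWeaklyDivFree (V n s))
    (hmild : ∀ n, ∀ s t : ℝ, A n < s → s < t → t ≤ 0 → ∀ x,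
      V n t x = heatExtension (V n s) (t - s) x - oseenDuhamel 1 s (V n) (V n) t x)
    (hγ1 : ∀ n, 1 ≤ γ n) (hγ : Tendsto γ atTop (𝓝 1)) {s : ℝ} (hs : s < 0) (y : (EuclideanSpace ℝ (Fin 3))) :
    Tendsto (fun n => (γ n)⁻¹ • V n (s / γ n ^ 2) ((γ n)⁻¹ • y) - V n s y) atTop (𝓝 0) := by
  have hγ0 : ∀ n, 0 < γ n := fun n => lt_of_lt_of_le one_pos (hγ1 n)
  have hs₀ : ∀ n, s ≤ s / γ n ^ 2 := fun n => by
    rw [le_div_iff₀ (pow_pos (hγ0 n) 2)]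
    nlinarith [one_le_pow₀ (hγ1 n) (n := 2), hs]
  have hs₀0 : ∀ n, s / γ n ^ 2 ≤ 0 := fun n => div_nonpos_of_nonpos_of_nonneg hs.le (pow_nonneg (hγ0 n).le 2)
  -- the bound sequence
  set b : ℕ → ℝ := fun n => (γ n)⁻¹ * (L * (|s / γ n ^ 2 - s| + ‖(γ n)⁻¹ • y - y‖)) + |(γ n)⁻¹ - 1| * 2 with hb
  have hγinv : Tendsto (fun n => (γ n)⁻¹) atTop (𝓝 1) := by simpa using hγ.inv₀ one_ne_zero
  have hb0 : Tendsto b atTop (𝓝 0) := by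
    have h1 : Tendsto (fun n => s / γ n ^ 2 - s) atTop (𝓝 0) := by
      have h := (tendsto_const_nhds (x := s)).div ((hγ.pow 2)) (by norm_num)
      simpa using h.sub_const s
    have h2 : Tendsto (fun n => (γ n)⁻¹ • y - y) atTop (𝓝 0) := by
      have h := hγinv.smul_const y
      simpa using h.sub_const y
    have h3 : Tendsto (fun n => |(γ n)⁻¹ - 1| * 2) atTop (𝓝 0) := by
      have h := ((hγinv.sub_const 1).abs).mul_const 2
      simpa using h
    have h4 : Tendsto (fun n => (γ n)⁻¹ * (L * (|s / γ n ^ 2 - s| + ‖(γ n)⁻¹ • y - y‖))) atTop (𝓝 0) := by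
      have h := hγinv.mul ((h1.abs.add h2.norm).const_mul L)
      simpa using h
    simpa [hb] using h4.add h3
  refine squeeze_zero_norm' ?_ hb0
  -- eventually the shifted window applies
  have hev1 : ∀ᶠ n in atTop, A n ≤ s - 3 := hAlim.eventually (eventually_le_atBot (s - 3))
  have hev2 : ∀ᶠ n in atTop, s / γ n ^ 2 - s ≤ 1 := by
    have h : Tendsto (fun n => s / γ n ^ 2 - s) atTop (𝓝 0) := by
      have h := (tendsto_const_nhds (x := s)).div ((hγ.pow 2)) (by norm_num)
      simpa using h.sub_const s
    exact h.eventually (eventually_le_nhds one_pos)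
  filter_upwards [hev1, hev2] with n hn1 hn2
  have hlip := windowLipschitz_shift hL (V n) (A n) (B n) (hs₀0 n) (by linarith [hs₀ n]) (hB n) (hcont n)
    (hbd n) (hdiv n) (hmild n) s ⟨by linarith, hs₀ n⟩ (s / γ n ^ 2) ⟨by linarith, le_rfl⟩ ((γ n)⁻¹ • y) y
  have hdecomp : (γ n)⁻¹ • V n (s / γ n ^ 2) ((γ n)⁻¹ • y) - V n s y =
      (γ n)⁻¹ • (V n (s / γ n ^ 2) ((γ n)⁻¹ • y) - V n s y) + ((γ n)⁻¹ - 1) • V n s y := by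
    rw [smul_sub, sub_smul, one_smul]; abel
  rw [hdecomp]
  have hAs : A n < s := by linarith
  calc ‖(γ n)⁻¹ • (V n (s / γ n ^ 2) ((γ n)⁻¹ • y) - V n s y) + ((γ n)⁻¹ - 1) • V n s y‖
      ≤ ‖(γ n)⁻¹ • (V n (s / γ n ^ 2) ((γ n)⁻¹ • y) - V n s y)‖ + ‖((γ n)⁻¹ - 1) • V n s y‖ := norm_add_le _ _
    _ ≤ (γ n)⁻¹ * (L * (|s / γ n ^ 2 - s| + ‖(γ n)⁻¹ • y - y‖)) + |(γ n)⁻¹ - 1| * 2 := by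
        rw [norm_smul, norm_smul, Real.norm_eq_abs, Real.norm_eq_abs, abs_of_pos (inv_pos.2 (hγ0 n))]
        exact add_le_add (mul_le_mul_of_nonneg_left hlip (inv_pos.2 (hγ0 n)).le)
          (mul_le_mul_of_nonneg_left (hbd n s ⟨hAs, hs.le⟩ y) (abs_nonneg _))
    _ = b n := by rw [hb]

end Summit.NavierStokesRegularity.NavierStokesRegularity.Theorems.CertifiedBlowupAxisymBlowup.CompactAmplification
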